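import Summits.BirchSwinnertonDyer.BirchSwinnertonDyer.Theorems.AlignedTransportAtTwoMainConjectureOfRankZeroBSDAtTwoFineRoadKleinCountingSteinberg
import Mathlib.Algebra.CharP.Lemmas
import HarnessLib

/-!
# Route `AlignedTransportAtTwo`, crux C2 `MainConjectureOfRankZeroBSDAtTwo` (stmt-BirchSwinnertonDyer-22298),
# road (b″): PERFECT DESCENT at `2`, part XV — CYCLIC `p`-DESCENT OF «`μ = 0`» THROUGH COINVARIANTS (Iwasawa 1973,
# module form: the case `p ∣ [L : F]` the transfer of part XIII cannot do) and the CUBIC DESCENT `μ(Y) = 0 ⟺ μ(X(F_∞)) = 0`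

Cell `bsd-f1-sign2`, WIDTH-5 attach seat `bsd-line-att-p3` (gen 6) on line `birth` of crux C2 (`--supports`
stmt-BirchSwinnertonDyer-22298; closes nothing). HONEST FRAMING: THEOREMS ONLY — no definition, no named fact, no instance,
no `sorry`; BSD is NOT proved by any of this; C2-NEUTRAL (the crux's open content stays the single invariant `μ(Y)` of part
XII, which this file identifies with the classical `μ₂` of the cubic field `F = ℚ(e₁)` — the lead's CENSUS-lead-g6 (A9)).

WHY. Parts XI–XIII split a finitely generated `Λ = ℤ₂⟦T⟧`-module `X` with `S₃`-relations as `X = (1+σ+σ²)X ⊕ W`,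
`W ≅ Y × Y` (`Y = W ⊓ X^τ`), and identified `(1+σ+σ²)X` with `X(K_∞)` through a transfer pair — possible because `3 ∈ Λˣ`.
For the quadratic step `τ` (`[L : F] = 2 = p`, `L = ℚ(W[2])`, `F = L^τ`) the degree is NOT a unit; PERFECT-DESCENT-KERNEL-att-p3.md
left «`Y` vs the cubic field's module ([Iw73] at `p = 2 = [L : F]`)» as the last non-kernel MODULE statement. Supplied here:
§1 nilpotent Nakayama at a prime (any commutative ring: `ν^k X ⊆ aX`, `a ∈ 𝔮`, `ℓ_𝔮(X/νX) = 0 ⟹ ℓ_𝔮(X) = 0`, on part X's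
global Nakayama); §2 `g^(pⁿ) = 1 ⟹ (g−1)^(pⁿ) ∈ p·End` (Mathlib `Commute.exists_add_pow_prime_pow_eq`), hence
`ℓ_𝔮(X) = 0 ⟺ ℓ_𝔮(X/(g−1)X) = 0` for `𝔮 ∋ p` and, over `Λ`, `X` torsion ∧ `μ = 0 ⟺` the same for the `g`-coinvariants —
the module core of Iwasawa's theorem «`μ(F_∞/F) = 0 ⟺ μ(L_∞/L) = 0` for a Galois `p`-extension `L/F`»; §3 bookkeeping
(genus sandwich `ℓ(X') ≤ ℓ(ker j) + ℓ(I) + ℓ(B)` for `j : X' → P ⊇ I`, `B ↠ P/I`; norm `ℓ(B) ≤ ℓ(X) + ℓ(B/nm X)`);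
§4 Iwasawa's theorem in module form `ℓ₍ₚ₎(X) = 0 ⟺ ℓ₍ₚ₎(B) = 0` given GENUS DATA `(j, I, q, nm)`; §5 `p = 2`, `Q̄ = S₃`:
`ℓ₍₂₎(B) = 0 ⟺ ℓ₍₂₎((1+σ+σ²)X) = 0 ∧ ℓ₍₂₎(Y) = 0` (no Ferrero–Washington input), and with `ℓ₍₂₎((1+σ+σ²)X) = 0` [FW]:
`Y` torsion ∧ `μ(Y) = 0 ⟺ B` torsion ∧ `μ(B) = 0 ⟺ Hom_Q(X, V₄)` finite.

WHAT THE GENUS DATA ARE (arithmetic, NOT in this file — same typing status as `X` itself in parts X–XIV). `𝒰` = «unramified at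
finite places, completely split above `Σ_f`» (relaxed at `∞`, att-p5's erratum); `X = X_𝒰(L_∞) = Gal(M/L_∞)`, `B = X_𝒰(F_∞)`,
`F_∞ = L_∞^τ`; `P = Gal(M₀/F_∞)`, `M₀ = M^{(τ−1)X}` (abelian over `F_∞`: central subgroup with cyclic quotient), so
`j : X_τ = Gal(M₀/L_∞) ↪ P` (index `2`, `ker j = 0`); `I ≤ P` generated by the decomposition groups above `Σ_f` (finitely many
places of `F_∞`, each group of order `≤ 2` as `M₀/L_∞ ∈ 𝒰`, `L/ℚ` unramified outside `Σ_f`), so `I` is FINITE and `M₀^I/F_∞ ∈ 𝒰`,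
i.e. `q : B ↠ P/I`; `nm` = restriction `X → Gal(M_F L_∞/L_∞) ↪ B`, cokernel of order `≤ 2` (Lang Ch. 13 §1 Lemma 1).

References: Iwasawa, *On the μ-invariants of ℤ_ℓ-extensions* (1973); Lang, *Cyclotomic Fields I–II*, Ch. 13 §1; Washington,
*Introduction to Cyclotomic Fields*, §13.2; Matsumura, *Commutative Ring Theory*, Thm. 2.2; CENSUS-lead-g6 (A9). -/

set_option autoImplicit false
-- the Theorems namespace of this sub repeats the summit name by design (D-0017 nested layout)
set_option linter.dupNamespace false

noncomputable section

namespace Summit.BirchSwinnertonDyer.BirchSwinnertonDyer.Theorems.AlignedTransportAtTwoFineRoad.CyclicDescent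

open Literature.NumberTheory.EllipticCurves Literature.NumberTheory.EllipticCurves.IwasawaAlgebra
  Literature.NumberTheory.EllipticCurves.Module Pointwise
open Summit.BirchSwinnertonDyer.BirchSwinnertonDyer.Theorems.AlignedTransportAtTwoFineRoad.PerfectDescent

/-! ## §1 Nilpotent Nakayama at a prime: `ν^k X ⊆ aX`, `a ∈ 𝔮`, `ℓ_𝔮(X/νX) = 0 ⟹ ℓ_𝔮(X) = 0` -/

section NilpotentNakayama

variable {R : Type*} [CommRing R] {X : Type*} [AddCommGroup X] [_root_.Module R X]

/-- Iteration: if every `x` is pushed into `νX` by some `s ∉ 𝔮` (i.e. `X_𝔮 = νX_𝔮`), then every `x` is pushed into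
`ν^k X` by some `s ∉ 𝔮` (i.e. `X_𝔮 = ν^k X_𝔮`), for every `k`. [folklore] -/
theorem forall_exists_notMem_smul_mem_range_pow (𝔮 : Ideal R) [h𝔮 : 𝔮.IsPrime] (ν : X →ₗ[R] X)
    (h : ∀ x : X, ∃ s ∉ 𝔮, s • x ∈ LinearMap.range ν) (k : ℕ) :
    ∀ x : X, ∃ s ∉ 𝔮, s • x ∈ LinearMap.range (ν ^ k) := by
  induction k with
  | zero => exact fun x ↦ ⟨1, fun h1 ↦ h𝔮.ne_top ((Ideal.eq_top_iff_one 𝔮).mpr h1), by simp⟩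
  | succ k ih =>
    intro x
    obtain ⟨s, hs, y, hy⟩ := ih x
    obtain ⟨t, ht, z, hz⟩ := h y
    refine ⟨t * s, fun hts ↦ (h𝔮.mem_or_mem hts).elim ht hs, z, ?_⟩
    rw [pow_succ, Module.End.mul_apply, hz, map_smul, hy, smul_smul]

/-- **Nilpotent Nakayama at a prime.** `X` finitely generated over a commutative ring `R`, `𝔮` prime, `a ∈ 𝔮`, `ν ∈ End_R(X)`
with `ν^k X ⊆ aX`: `ℓ_𝔮(X/νX) = 0 ⟹ ℓ_𝔮(X) = 0` (`X_𝔮 = νX_𝔮 = ⋯ = ν^kX_𝔮 ⊆ aX_𝔮 ⊆ 𝔮X_𝔮`, then part X's global Nakayama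
`exists_notMem_forall_smul_eq_zero_of_quotient`). [cite: Matsumura1987, Thm. 2.2 (Nakayama)] -/
theorem lengthAt_eq_zero_of_lengthAt_quotient_range_eq_zero [Module.Finite R X] (𝔮 : PrimeSpectrum R) {a : R}
    (ha : a ∈ 𝔮.asIdeal) (ν : X →ₗ[R] X) {k : ℕ} (hν : LinearMap.range (ν ^ k) ≤ a • (⊤ : Submodule R X))
    (h0 : lengthAt R (X ⧸ LinearMap.range ν) 𝔮 = 0) : lengthAt R X 𝔮 = 0 := by
  rw [lengthAt_eq_zero_iff, LocalizedModule.subsingleton_iff] at h0 ⊢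
  have h1 : ∀ x : X, ∃ s ∉ 𝔮.asIdeal, s • x ∈ LinearMap.range ν := fun x ↦ by
    obtain ⟨s, hs, hs0⟩ := h0 (Submodule.Quotient.mk x)
    exact ⟨s, hs, by rwa [← Submodule.Quotient.mk_smul, Submodule.Quotient.mk_eq_zero] at hs0⟩
  obtain ⟨r, hr, hr0⟩ := exists_notMem_forall_smul_eq_zero_of_quotient (Y := X) 𝔮.asIdeal ha (fun x ↦ by
    obtain ⟨s, hs, hsx⟩ := forall_exists_notMem_smul_mem_range_pow 𝔮.asIdeal ν h1 k x
    exact ⟨s, hs, hν hsx⟩)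
  exact fun x ↦ ⟨r, hr, hr0 x⟩

/-- **`ℓ_𝔮(X) = 0 ⟺ ℓ_𝔮(X/νX) = 0`** under `ν^k X ⊆ aX`, `a ∈ 𝔮` (`⟸` is the nilpotent Nakayama lemma, `⟹` because
`X ↠ X/νX`). [cite: Matsumura1987, Thm. 2.2 (Nakayama)] -/
theorem lengthAt_eq_zero_iff_lengthAt_quotient_range_eq_zero [Module.Finite R X] (𝔮 : PrimeSpectrum R) {a : R}
    (ha : a ∈ 𝔮.asIdeal) (ν : X →ₗ[R] X) {k : ℕ} (hν : LinearMap.range (ν ^ k) ≤ a • (⊤ : Submodule R X)) :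
    lengthAt R X 𝔮 = 0 ↔ lengthAt R (X ⧸ LinearMap.range ν) 𝔮 = 0 :=
  ⟨fun h ↦ nonpos_iff_eq_zero.mp (h ▸ lengthAt_quotient_le (LinearMap.range ν) 𝔮),
    lengthAt_eq_zero_of_lengthAt_quotient_range_eq_zero 𝔮 ha ν hν⟩

end NilpotentNakayama

/-! ## §2 An automorphism of `p`-power order: `(g − 1)^(pⁿ) ∈ p·End`, so `ℓ_𝔮(X) = 0 ⟺ ℓ_𝔮(X/(g−1)X) = 0` for `𝔮 ∋ p` -/

section PrimePowerOrder

/-- **`g^(pⁿ) = 1 ⟹ (g − 1)^(pⁿ) ∈ p·A`** in any ring: `(g + (−1))^(pⁿ) = g^(pⁿ) + (−1)^(pⁿ) + p·g·(−1)·r` (Mathlib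
`Commute.exists_add_pow_prime_pow_eq`) and `1 + (−1)^(pⁿ) ∈ {0, 2}`, `= 2` only when `p = 2` (nilpotence in `𝔽_p[C_{pⁿ}]`). [folklore] -/
theorem exists_sub_one_pow_prime_pow_eq_mul {A : Type*} [Ring A] {p : ℕ} (hp : p.Prime) {g : A} {n : ℕ}
    (hg : g ^ p ^ n = 1) : ∃ r : A, (g - 1) ^ p ^ n = (p : A) * r := by
  obtain ⟨r, hr⟩ := (Commute.neg_one_right g).exists_add_pow_prime_pow_eq hp n
  rw [← sub_eq_add_neg, hg] at hr
  rcases (p ^ n).even_or_odd with he | ho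
  · have hp2 : p = 2 := (Nat.Prime.even_iff hp).mp (Nat.even_pow.mp he).1
    exact ⟨1 - g * r, by rw [hr, he.neg_one_pow, hp2]; push_cast; noncomm_ring⟩
  · exact ⟨-(g * r), by rw [hr, ho.neg_one_pow]; noncomm_ring⟩

variable {R : Type*} [CommRing R] {X : Type*} [AddCommGroup X] [_root_.Module R X]

/-- For `g ∈ End_R(X)` with `g^(pⁿ) = 1`: `(g − 1)^(pⁿ) X ⊆ p·X`. [folklore] -/
theorem range_sub_one_pow_le_smul_top {p : ℕ} (hp : p.Prime) (g : X →ₗ[R] X) {n : ℕ} (hg : g ^ p ^ n = 1) :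
    LinearMap.range ((g - 1) ^ p ^ n) ≤ (p : R) • (⊤ : Submodule R X) := by
  obtain ⟨r, hr⟩ := exists_sub_one_pow_prime_pow_eq_mul hp hg
  rintro _ ⟨x, rfl⟩
  rw [hr, Module.End.mul_apply, Module.End.natCast_apply, ← Nat.cast_smul_eq_nsmul R]
  exact Submodule.smul_mem_pointwise_smul _ _ _ Submodule.mem_top

/-- **`ℓ_𝔮(X) = 0 ⟺ ℓ_𝔮(X/(g − 1)X) = 0`** for `X` finitely generated over a commutative ring `R`, `𝔮` a prime containing
(the image of) the prime number `p`, and `g ∈ End_R(X)` with `g^(pⁿ) = 1`: `𝔮` sees `X` exactly through its `g`-coinvariants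
(the module step of Iwasawa's theorem on `μ` in `p`-extensions). [cite: Iwasawa1973MuInvariants, pp. 1–11 (μ in Galois ℓ-extensions)] -/
theorem lengthAt_eq_zero_iff_coinvariants [Module.Finite R X] (𝔮 : PrimeSpectrum R) {p : ℕ} (hp : p.Prime)
    (hp𝔮 : (p : R) ∈ 𝔮.asIdeal) (g : X →ₗ[R] X) {n : ℕ} (hg : g ^ p ^ n = 1) :
    lengthAt R X 𝔮 = 0 ↔ lengthAt R (X ⧸ LinearMap.range (g - 1)) 𝔮 = 0 :=
  lengthAt_eq_zero_iff_lengthAt_quotient_range_eq_zero 𝔮 hp𝔮 (g - 1) (range_sub_one_pow_le_smul_top hp g hg)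

end PrimePowerOrder

section Lambda

variable (p : ℕ) [Fact p.Prime] {X : Type*} [AddCommGroup X] [_root_.Module (IwasawaAlgebra p) X]

/-- Over `Λ = ℤ_p⟦T⟧` at the height-one prime `(p)`: **`ℓ₍ₚ₎(X) = 0 ⟺ ℓ₍ₚ₎(X/(g − 1)X) = 0`** for `X` finitely generated
and `g` a `Λ`-linear automorphism with `g^(pⁿ) = 1`. [cite: Iwasawa1973MuInvariants, pp. 1–11 (μ in Galois ℓ-extensions)] -/
theorem lengthAt_augIdealP_eq_zero_iff_coinvariants [Module.Finite (IwasawaAlgebra p) X]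
    (g : X →ₗ[IwasawaAlgebra p] X) {n : ℕ} (hg : g ^ p ^ n = 1) :
    lengthAt (IwasawaAlgebra p) X ⟨augIdealP p, isPrime_augIdealP_holds p⟩ = 0 ↔
      lengthAt (IwasawaAlgebra p) (X ⧸ LinearMap.range (g - 1)) ⟨augIdealP p, isPrime_augIdealP_holds p⟩ = 0 := by
  have hpmem : ((p : ℕ) : IwasawaAlgebra p) ∈ augIdealP p := by
    rw [← map_natCast (PowerSeries.C (R := ℤ_[p])) p]
    exact Ideal.mem_span_singleton_self _
  exact lengthAt_eq_zero_iff_coinvariants _ (Fact.out : p.Prime) hpmem g hg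

/-- **«`μ = 0`» DESCENDS AND LIFTS THROUGH COINVARIANTS OF A `p`-POWER-ORDER AUTOMORPHISM.** For `X` finitely generated
over `Λ = ℤ_p⟦T⟧` and `g ∈ End_Λ(X)` with `g^(pⁿ) = 1`: `X` is `Λ`-torsion with `μ(X) = 0` iff `X/(g − 1)X` is `Λ`-torsion
with `μ = 0` (part X on both sides; genus theory then compares the coinvariants with `X(F_∞)`, §3–§4).
[cite: Iwasawa1973MuInvariants, pp. 1–11 (μ in Galois ℓ-extensions)] -/
theorem isTorsion_and_muInvariant_eq_zero_iff_coinvariants [Module.Finite (IwasawaAlgebra p) X]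
    (g : X →ₗ[IwasawaAlgebra p] X) {n : ℕ} (hg : g ^ p ^ n = 1) :
    (Module.IsTorsion (IwasawaAlgebra p) X ∧ muInvariant p X = 0) ↔
      (Module.IsTorsion (IwasawaAlgebra p) (X ⧸ LinearMap.range (g - 1)) ∧
        muInvariant p (X ⧸ LinearMap.range (g - 1)) = 0) := by
  rw [← lengthAt_augIdealP_eq_zero_iff_isTorsion_and_muInvariant_eq_zero,
    ← lengthAt_augIdealP_eq_zero_iff_isTorsion_and_muInvariant_eq_zero, lengthAt_augIdealP_eq_zero_iff_coinvariants p g hg]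

end Lambda

/-! ## §3 Bookkeeping: the genus sandwich `X' → P ⊇ I`, `B ↠ P/I`, and the norm `X → B` -/

section Genus

variable {R : Type*} [CommRing R] {X' : Type*} [AddCommGroup X'] [_root_.Module R X']
  {P : Type*} [AddCommGroup P] [_root_.Module R P] {B : Type*} [AddCommGroup B] [_root_.Module R B]

/-- **Genus sandwich.** `j : X' → P` linear, `I ≤ P`, `q : B ↠ P/I` ⟹ `ℓ_𝔮(X') ≤ ℓ_𝔮(ker j) + (ℓ_𝔮(I) + ℓ_𝔮(B))`
(`ℓ(X') = ℓ(ker j) + ℓ(jX')`, `jX' ≤ P`, `ℓ(P) = ℓ(I) + ℓ(P/I) ≤ ℓ(I) + ℓ(B)`); in the application `X' = X(L_∞)_τ`,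
`P = Gal(M₀/F_∞)`, `I` the (finite) decomposition subgroup, `B = X(F_∞)`. [cite: Lang1990, Ch. 13 §1, Lemma 1 and Lemma 3] -/
theorem lengthAt_le_of_genus (j : X' →ₗ[R] P) (I : Submodule R P) (q : B →ₗ[R] P ⧸ I)
    (hq : Function.Surjective q) (𝔮 : PrimeSpectrum R) :
    lengthAt R X' 𝔮 ≤ lengthAt R (LinearMap.ker j) 𝔮 + (lengthAt R I 𝔮 + lengthAt R B 𝔮) := by
  rw [lengthAt_eq_add_quotient (LinearMap.ker j) 𝔮]
  refine add_le_add le_rfl ?_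
  calc lengthAt R (X' ⧸ LinearMap.ker j) 𝔮
      = lengthAt R (LinearMap.range j) 𝔮 := lengthAt_eq_of_linearEquiv j.quotKerEquivRange 𝔮
    _ ≤ lengthAt R P 𝔮 := lengthAt_submodule_le (LinearMap.range j) 𝔮
    _ = lengthAt R I 𝔮 + lengthAt R (P ⧸ I) 𝔮 := lengthAt_eq_add_quotient I 𝔮
    _ ≤ lengthAt R I 𝔮 + lengthAt R B 𝔮 := add_le_add le_rfl (lengthAt_le_of_surjective q hq 𝔮)

/-- Genus sandwich, vanishing form: `ℓ(ker j) = ℓ(I) = ℓ(B) = 0 ⟹ ℓ(X') = 0`. [cite: Lang1990, Ch. 13 §1, Lemma 1 and Lemma 3] -/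
theorem lengthAt_eq_zero_of_genus (j : X' →ₗ[R] P) (I : Submodule R P) (q : B →ₗ[R] P ⧸ I)
    (hq : Function.Surjective q) (𝔮 : PrimeSpectrum R) (hj : lengthAt R (LinearMap.ker j) 𝔮 = 0)
    (hI : lengthAt R I 𝔮 = 0) (hB : lengthAt R B 𝔮 = 0) : lengthAt R X' 𝔮 = 0 :=
  nonpos_iff_eq_zero.mp (by simpa only [hj, hI, hB, zero_add] using lengthAt_le_of_genus j I q hq 𝔮)

variable {X : Type*} [AddCommGroup X] [_root_.Module R X]

/-- **Norm bookkeeping.** `nm : X → B` linear ⟹ `ℓ_𝔮(B) ≤ ℓ_𝔮(X) + ℓ_𝔮(B/nm X)`; in the application `nm` is the restriction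
`X(L_∞) → X(F_∞)`, cokernel of order `≤ [L : F]` («the norm is quasi-surjective»). [cite: Lang1990, Ch. 13 §1, Lemma 1 (proof)] -/
theorem lengthAt_le_of_norm (nm : X →ₗ[R] B) (𝔮 : PrimeSpectrum R) :
    lengthAt R B 𝔮 ≤ lengthAt R X 𝔮 + lengthAt R (B ⧸ LinearMap.range nm) 𝔮 := by
  rw [lengthAt_eq_add_quotient (LinearMap.range nm) 𝔮]
  exact add_le_add (lengthAt_le_of_surjective nm.rangeRestrict nm.surjective_rangeRestrict 𝔮) le_rfl

/-- Norm bookkeeping, vanishing form: `ℓ(X) = 0`, `ℓ(B/nm X) = 0 ⟹ ℓ(B) = 0` («`μ(F) ≤ μ(L)`»).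
[cite: Lang1990, Ch. 13 §1, Lemma 1] -/
theorem lengthAt_eq_zero_of_norm (nm : X →ₗ[R] B) (𝔮 : PrimeSpectrum R)
    (hX : lengthAt R X 𝔮 = 0) (hc : lengthAt R (B ⧸ LinearMap.range nm) 𝔮 = 0) : lengthAt R B 𝔮 = 0 :=
  nonpos_iff_eq_zero.mp (by simpa only [hX, hc, zero_add] using lengthAt_le_of_norm nm 𝔮)

end Genus

/-! ## §4 Iwasawa's theorem in module form: `ℓ₍ₚ₎(X) = 0 ⟺ ℓ₍ₚ₎(B) = 0` given genus data for a `p`-power-order automorphism -/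

section GenusLambda

variable (p : ℕ) [Fact p.Prime] {X : Type*} [AddCommGroup X] [_root_.Module (IwasawaAlgebra p) X]
  {P : Type*} [AddCommGroup P] [_root_.Module (IwasawaAlgebra p) P]
  {B : Type*} [AddCommGroup B] [_root_.Module (IwasawaAlgebra p) B]

/-- An injective map has `ℓ(ker) = 0` (the form in which the genus data of §4 are usually met: `X_g ↪ P`). [folklore] -/
theorem lengthAt_ker_eq_zero_of_injective {R : Type*} [CommRing R] {Y : Type*} [AddCommGroup Y] [_root_.Module R Y]
    {Z : Type*} [AddCommGroup Z] [_root_.Module R Z] (j : Y →ₗ[R] Z) (hj : Function.Injective j)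
    (𝔮 : PrimeSpectrum R) : lengthAt R (LinearMap.ker j) 𝔮 = 0 := by
  rw [LinearMap.ker_eq_bot.mpr hj]
  exact lengthAt_eq_zero_of_subsingleton _

/-- **IWASAWA'S THEOREM ON `μ` IN `p`-EXTENSIONS, MODULE FORM.** `X` finitely generated over `Λ = ℤ_p⟦T⟧`, `g ∈ End_Λ(X)`
with `g^(pⁿ) = 1`, and GENUS DATA: `Λ`-linear `j : X/(g−1)X → P` with `ℓ₍ₚ₎(ker j) = 0`, a submodule `I ≤ P` with
`ℓ₍ₚ₎(I) = 0`, a `Λ`-linear surjection `q : B ↠ P/I`, and `nm : X → B` with `ℓ₍ₚ₎(B/nm X) = 0`. THEN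
`ℓ₍ₚ₎(X) = 0 ⟺ ℓ₍ₚ₎(B) = 0` (`⟹` norm bookkeeping; `⟸` genus sandwich for `X/(g−1)X`, then §2); with `X = X(L_∞)`,
`B = X(F_∞)`, `Gal(L_∞/F_∞) = ⟨g⟩ ≅ C_{pⁿ}`: «`μ(L_∞/L) = 0 ⟺ μ(F_∞/F) = 0`». [cite: Iwasawa1973MuInvariants, pp. 1–11 (μ in Galois ℓ-extensions)] -/
theorem lengthAt_augIdealP_eq_zero_iff_of_genusData [Module.Finite (IwasawaAlgebra p) X]
    (g : X →ₗ[IwasawaAlgebra p] X) {n : ℕ} (hg : g ^ p ^ n = 1)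
    (j : (X ⧸ LinearMap.range (g - 1)) →ₗ[IwasawaAlgebra p] P)
    (hj : lengthAt (IwasawaAlgebra p) (LinearMap.ker j) ⟨augIdealP p, isPrime_augIdealP_holds p⟩ = 0)
    (I : Submodule (IwasawaAlgebra p) P)
    (hI : lengthAt (IwasawaAlgebra p) I ⟨augIdealP p, isPrime_augIdealP_holds p⟩ = 0)
    (q : B →ₗ[IwasawaAlgebra p] P ⧸ I) (hq : Function.Surjective q)
    (nm : X →ₗ[IwasawaAlgebra p] B)
    (hnm : lengthAt (IwasawaAlgebra p) (B ⧸ LinearMap.range nm) ⟨augIdealP p, isPrime_augIdealP_holds p⟩ = 0) :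
    lengthAt (IwasawaAlgebra p) X ⟨augIdealP p, isPrime_augIdealP_holds p⟩ = 0 ↔
      lengthAt (IwasawaAlgebra p) B ⟨augIdealP p, isPrime_augIdealP_holds p⟩ = 0 := by
  constructor
  · exact fun hX ↦ lengthAt_eq_zero_of_norm nm _ hX hnm
  · intro hB
    rw [lengthAt_augIdealP_eq_zero_iff_coinvariants p g hg]
    exact lengthAt_eq_zero_of_genus j I q hq _ hj hI hB

/-- The same in the words of the crux notes: under the genus data, **`X` is `Λ`-torsion with `μ(X) = 0 ⟺ B` is `Λ`-torsion
with `μ(B) = 0`**. [cite: Iwasawa1973MuInvariants, pp. 1–11 (μ in Galois ℓ-extensions)] -/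
theorem isTorsion_and_muInvariant_eq_zero_iff_of_genusData [Module.Finite (IwasawaAlgebra p) X]
    [Module.Finite (IwasawaAlgebra p) B]
    (g : X →ₗ[IwasawaAlgebra p] X) {n : ℕ} (hg : g ^ p ^ n = 1)
    (j : (X ⧸ LinearMap.range (g - 1)) →ₗ[IwasawaAlgebra p] P)
    (hj : lengthAt (IwasawaAlgebra p) (LinearMap.ker j) ⟨augIdealP p, isPrime_augIdealP_holds p⟩ = 0)
    (I : Submodule (IwasawaAlgebra p) P)
    (hI : lengthAt (IwasawaAlgebra p) I ⟨augIdealP p, isPrime_augIdealP_holds p⟩ = 0)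
    (q : B →ₗ[IwasawaAlgebra p] P ⧸ I) (hq : Function.Surjective q)
    (nm : X →ₗ[IwasawaAlgebra p] B)
    (hnm : lengthAt (IwasawaAlgebra p) (B ⧸ LinearMap.range nm) ⟨augIdealP p, isPrime_augIdealP_holds p⟩ = 0) :
    (Module.IsTorsion (IwasawaAlgebra p) X ∧ muInvariant p X = 0) ↔
      (Module.IsTorsion (IwasawaAlgebra p) B ∧ muInvariant p B = 0) := by
  rw [← lengthAt_augIdealP_eq_zero_iff_isTorsion_and_muInvariant_eq_zero,
    ← lengthAt_augIdealP_eq_zero_iff_isTorsion_and_muInvariant_eq_zero]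
  exact lengthAt_augIdealP_eq_zero_iff_of_genusData p g hg j hj I hI q hq nm hnm

end GenusLambda

/-! ## §5 `p = 2`, `Q̄ = S₃`: the quadratic step `τ` and the CUBIC DESCENT `μ(Y) = 0 ⟺ μ(X(F_∞)) = 0` -/

section CubicDescent

variable {Q : Type*} [Group Q] {M : Type*} [AddCommGroup M] [DistribMulAction Q M]
  {X : Type*} [AddCommGroup X] [_root_.Module (IwasawaAlgebra 2) X] [DistribMulAction Q X]
  [SMulCommClass Q (IwasawaAlgebra 2) X]
  {P : Type*} [AddCommGroup P] [_root_.Module (IwasawaAlgebra 2) P]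
  {B : Type*} [AddCommGroup B] [_root_.Module (IwasawaAlgebra 2) B]

/-- `τ² = 1` on `X` as an identity of `Λ`-linear maps: `(τ)^(2¹) = 1`. [folklore] -/
theorem toLinearMap_pow_two_pow_one_eq_one {τ : Q} (hττ : ∀ x : X, τ • (τ • x) = x) :
    (DistribSMul.toLinearMap (IwasawaAlgebra 2) X τ) ^ 2 ^ 1 = 1 := by
  rw [pow_one, pow_two]
  ext x
  rw [Module.End.mul_apply, Module.End.one_apply, DistribSMul.toLinearMap_apply, DistribSMul.toLinearMap_apply, hττ]

/-- **The quadratic step.** For `X` finitely generated over `Λ = ℤ₂⟦T⟧` with a `Λ`-linear involution `τ`: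
`ℓ₍₂₎(X) = 0 ⟺ ℓ₍₂₎(X/(τ−1)X) = 0` (`(τ − 1)² = 2(1 − τ) ∈ 2·End`). [cite: Iwasawa1973MuInvariants, pp. 1–11 (μ in Galois ℓ-extensions)] -/
theorem lengthAt_two_eq_zero_iff_coinvariants_tau [Module.Finite (IwasawaAlgebra 2) X] {τ : Q}
    (hττ : ∀ x : X, τ • (τ • x) = x) :
    lengthAt (IwasawaAlgebra 2) X ⟨augIdealP 2, isPrime_augIdealP_holds 2⟩ = 0 ↔
      lengthAt (IwasawaAlgebra 2)
          (X ⧸ LinearMap.range (DistribSMul.toLinearMap (IwasawaAlgebra 2) X τ - LinearMap.id))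
          ⟨augIdealP 2, isPrime_augIdealP_holds 2⟩ = 0 :=
  lengthAt_augIdealP_eq_zero_iff_coinvariants 2 _ (toLinearMap_pow_two_pow_one_eq_one hττ)

/-- **The quadratic step with genus data**: `ℓ₍₂₎(X) = 0 ⟺ ℓ₍₂₎(B) = 0` for a `Λ`-linear involution `τ` and genus data
`(j, I, q, nm)` for `X/(τ−1)X` (§4, `p = 2`, `n = 1`; `X = X_𝒰(ℚ_∞(W[2]))`, `B = X_𝒰(ℚ_∞(e₁))`). [cite: Iwasawa1973MuInvariants, pp. 1–11 (μ in Galois ℓ-extensions)] -/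
theorem lengthAt_two_eq_zero_iff_of_genusData [Module.Finite (IwasawaAlgebra 2) X] {τ : Q}
    (hττ : ∀ x : X, τ • (τ • x) = x)
    (j : (X ⧸ LinearMap.range (DistribSMul.toLinearMap (IwasawaAlgebra 2) X τ - LinearMap.id)) →ₗ[IwasawaAlgebra 2] P)
    (hj : lengthAt (IwasawaAlgebra 2) (LinearMap.ker j) ⟨augIdealP 2, isPrime_augIdealP_holds 2⟩ = 0)
    (I : Submodule (IwasawaAlgebra 2) P)
    (hI : lengthAt (IwasawaAlgebra 2) I ⟨augIdealP 2, isPrime_augIdealP_holds 2⟩ = 0)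
    (q : B →ₗ[IwasawaAlgebra 2] P ⧸ I) (hq : Function.Surjective q)
    (nm : X →ₗ[IwasawaAlgebra 2] B)
    (hnm : lengthAt (IwasawaAlgebra 2) (B ⧸ LinearMap.range nm) ⟨augIdealP 2, isPrime_augIdealP_holds 2⟩ = 0) :
    lengthAt (IwasawaAlgebra 2) X ⟨augIdealP 2, isPrime_augIdealP_holds 2⟩ = 0 ↔
      lengthAt (IwasawaAlgebra 2) B ⟨augIdealP 2, isPrime_augIdealP_holds 2⟩ = 0 :=
  lengthAt_augIdealP_eq_zero_iff_of_genusData 2 _ (toLinearMap_pow_two_pow_one_eq_one hττ) j hj I hI q hq nm hnm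

/-- **CUBIC DESCENT, length form — NO Ferrero–Washington input.** `X` finitely generated over `Λ = ℤ₂⟦T⟧` with `Λ`-linear
`S₃`-relations `σ³ = 1`, `τ² = 1`, `τσ = σ²τ`, genus data for `τ`: `ℓ₍₂₎(B) = 0 ⟺ ℓ₍₂₎((1+σ+σ²)X) = 0 ∧ ℓ₍₂₎(Y) = 0`,
`Y = ker(1+σ+σ²) ⊓ X^τ` (part XII: `ℓ(X) = ℓ(NX) + 2ℓ(Y)`) — «`μ₂(ℚ(e₁)) = 0 ⟺ μ₂(ℚ(√Δ_W)) = 0 ∧ μ(Y) = 0`».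
[cite: Iwasawa1973MuInvariants, pp. 1–11 (μ in Galois ℓ-extensions)] [cite: Washington1997, §13.2] -/
theorem lengthAt_two_eq_zero_iff_norm_and_fixed_of_genusData [Module.Finite (IwasawaAlgebra 2) X] {σ τ : Q}
    (hσ3 : ∀ x : X, σ • (σ • (σ • x)) = x) (hττ : ∀ x : X, τ • (τ • x) = x)
    (hτσ : ∀ x : X, τ • (σ • x) = σ • (σ • (τ • x)))
    (j : (X ⧸ LinearMap.range (DistribSMul.toLinearMap (IwasawaAlgebra 2) X τ - LinearMap.id)) →ₗ[IwasawaAlgebra 2] P)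
    (hj : lengthAt (IwasawaAlgebra 2) (LinearMap.ker j) ⟨augIdealP 2, isPrime_augIdealP_holds 2⟩ = 0)
    (I : Submodule (IwasawaAlgebra 2) P)
    (hI : lengthAt (IwasawaAlgebra 2) I ⟨augIdealP 2, isPrime_augIdealP_holds 2⟩ = 0)
    (q : B →ₗ[IwasawaAlgebra 2] P ⧸ I) (hq : Function.Surjective q)
    (nm : X →ₗ[IwasawaAlgebra 2] B)
    (hnm : lengthAt (IwasawaAlgebra 2) (B ⧸ LinearMap.range nm) ⟨augIdealP 2, isPrime_augIdealP_holds 2⟩ = 0) :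
    lengthAt (IwasawaAlgebra 2) B ⟨augIdealP 2, isPrime_augIdealP_holds 2⟩ = 0 ↔
      lengthAt (IwasawaAlgebra 2)
            (LinearMap.range (LinearMap.id + DistribSMul.toLinearMap (IwasawaAlgebra 2) X σ +
              (DistribSMul.toLinearMap (IwasawaAlgebra 2) X σ).comp (DistribSMul.toLinearMap (IwasawaAlgebra 2) X σ)))
            ⟨augIdealP 2, isPrime_augIdealP_holds 2⟩ = 0 ∧
        lengthAt (IwasawaAlgebra 2)
            (↥(LinearMap.ker (LinearMap.id + DistribSMul.toLinearMap (IwasawaAlgebra 2) X σ +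
                (DistribSMul.toLinearMap (IwasawaAlgebra 2) X σ).comp (DistribSMul.toLinearMap (IwasawaAlgebra 2) X σ)) ⊓
              LinearMap.ker (DistribSMul.toLinearMap (IwasawaAlgebra 2) X τ - LinearMap.id)))
            ⟨augIdealP 2, isPrime_augIdealP_holds 2⟩ = 0 := by
  rw [← lengthAt_two_eq_zero_iff_of_genusData hττ j hj I hI q hq nm hnm,
    lengthAt_eq_lengthAt_range_norm_add_two_mul hσ3 hττ hτσ, add_eq_zero, mul_eq_zero,
    or_iff_right (two_ne_zero (α := ℕ∞))]

/-- **CUBIC DESCENT through the single invariant, with the Ferrero–Washington input `ℓ₍₂₎((1+σ+σ²)X) = 0`** (part XIII: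
`(1+σ+σ²)X ≅ X(K_∞)`, `K = ℚ(√Δ_W)` abelian): `Y` is `Λ`-torsion with `μ(Y) = 0 ⟺ B` is `Λ`-torsion with `μ(B) = 0` — the
lead's CENSUS-lead-g6 (A9) «same single invariant `μ(Y)`, reached through the cubic `F = ℚ(e₁)`» as a statement about modules.
[cite: Iwasawa1973MuInvariants, pp. 1–11 (μ in Galois ℓ-extensions)] [cite: Washington1997, §13.2] -/
theorem isTorsion_and_muInvariant_eq_zero_fixed_iff_of_genusData [Module.Finite (IwasawaAlgebra 2) X]
    [Module.Finite (IwasawaAlgebra 2) B] {σ τ : Q}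
    (hσ3 : ∀ x : X, σ • (σ • (σ • x)) = x) (hττ : ∀ x : X, τ • (τ • x) = x)
    (hτσ : ∀ x : X, τ • (σ • x) = σ • (σ • (τ • x)))
    (hFW : lengthAt (IwasawaAlgebra 2)
      (LinearMap.range (LinearMap.id + DistribSMul.toLinearMap (IwasawaAlgebra 2) X σ +
        (DistribSMul.toLinearMap (IwasawaAlgebra 2) X σ).comp (DistribSMul.toLinearMap (IwasawaAlgebra 2) X σ)))
      ⟨augIdealP 2, isPrime_augIdealP_holds 2⟩ = 0)
    (j : (X ⧸ LinearMap.range (DistribSMul.toLinearMap (IwasawaAlgebra 2) X τ - LinearMap.id)) →ₗ[IwasawaAlgebra 2] P)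
    (hj : lengthAt (IwasawaAlgebra 2) (LinearMap.ker j) ⟨augIdealP 2, isPrime_augIdealP_holds 2⟩ = 0)
    (I : Submodule (IwasawaAlgebra 2) P)
    (hI : lengthAt (IwasawaAlgebra 2) I ⟨augIdealP 2, isPrime_augIdealP_holds 2⟩ = 0)
    (q : B →ₗ[IwasawaAlgebra 2] P ⧸ I) (hq : Function.Surjective q)
    (nm : X →ₗ[IwasawaAlgebra 2] B)
    (hnm : lengthAt (IwasawaAlgebra 2) (B ⧸ LinearMap.range nm) ⟨augIdealP 2, isPrime_augIdealP_holds 2⟩ = 0) :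
    (Module.IsTorsion (IwasawaAlgebra 2)
          (↥(LinearMap.ker (LinearMap.id + DistribSMul.toLinearMap (IwasawaAlgebra 2) X σ +
              (DistribSMul.toLinearMap (IwasawaAlgebra 2) X σ).comp (DistribSMul.toLinearMap (IwasawaAlgebra 2) X σ)) ⊓
            LinearMap.ker (DistribSMul.toLinearMap (IwasawaAlgebra 2) X τ - LinearMap.id))) ∧
        muInvariant 2
          (↥(LinearMap.ker (LinearMap.id + DistribSMul.toLinearMap (IwasawaAlgebra 2) X σ +
              (DistribSMul.toLinearMap (IwasawaAlgebra 2) X σ).comp (DistribSMul.toLinearMap (IwasawaAlgebra 2) X σ)) ⊓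
            LinearMap.ker (DistribSMul.toLinearMap (IwasawaAlgebra 2) X τ - LinearMap.id))) = 0) ↔
      (Module.IsTorsion (IwasawaAlgebra 2) B ∧ muInvariant 2 B = 0) := by
  haveI : IsNoetherian (IwasawaAlgebra 2) X := isNoetherian_of_isNoetherianRing_of_finite _ _
  rw [← lengthAt_augIdealP_eq_zero_iff_isTorsion_and_muInvariant_eq_zero,
    ← lengthAt_augIdealP_eq_zero_iff_isTorsion_and_muInvariant_eq_zero,
    lengthAt_two_eq_zero_iff_norm_and_fixed_of_genusData hσ3 hττ hτσ j hj I hI q hq nm hnm, hFW]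
  simp only [true_and]

/-- **COUNTING LEMMA IN THE CUBIC FIELD'S CURRENCY.** `Q` acts on the Klein four-group `M` through `Aut(M) ≅ S₃` (`σ`
fixed-point-free; `τ ≠ 1` fixing `m₀ ≠ 0`, so `F = ℚ(e₁)` is the field of the `τ`-fixed point) and `Λ`-linearly on the finitely
generated `Λ = ℤ₂⟦T⟧`-module `X`, the kernel acting trivially; FW input `ℓ₍₂₎((1+σ+σ²)X) = 0`; genus data `(j, I, q, nm)` for `τ`.
THEN `Hom_Q(X, V₄)` is finite ⟺ `B` is `Λ`-torsion with `μ(B) = 0` (with parts II/V + att-p5's RatTwo Hom-set and the dictionary: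
«`Sel₀^{rel ∞}(ℚ_∞, W[2])` finite ⟺ `μ₂(ℚ(e₁)) = 0`»). [cite: SerreGaloisCohomology1997, I §5.1] [cite: Iwasawa1973MuInvariants, pp. 1–11 (μ in Galois ℓ-extensions)] -/
theorem finite_equivariant_iff_isTorsion_and_muInvariant_eq_zero_cubic
    [Module.Finite (IwasawaAlgebra 2) X] [Module.Finite (IwasawaAlgebra 2) B]
    (h4 : Nat.card M = 4) (h2 : ∀ m : M, m + m = 0) {σ τ : Q}
    {m₀ : M} (hσ : ∀ m : M, σ • m = m → m = 0) (hm₀ : m₀ ≠ 0) (hτ0 : τ • m₀ = m₀)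
    (hτ : ¬ ∀ m : M, τ • m = m) (hVN : ∀ g : Q, (∀ m : M, g • m = m) → ∀ x : X, g • x = x)
    (hFW : lengthAt (IwasawaAlgebra 2)
      (LinearMap.range (LinearMap.id + DistribSMul.toLinearMap (IwasawaAlgebra 2) X σ +
        (DistribSMul.toLinearMap (IwasawaAlgebra 2) X σ).comp (DistribSMul.toLinearMap (IwasawaAlgebra 2) X σ)))
      ⟨augIdealP 2, isPrime_augIdealP_holds 2⟩ = 0)
    (j : (X ⧸ LinearMap.range (DistribSMul.toLinearMap (IwasawaAlgebra 2) X τ - LinearMap.id)) →ₗ[IwasawaAlgebra 2] P)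
    (hj : lengthAt (IwasawaAlgebra 2) (LinearMap.ker j) ⟨augIdealP 2, isPrime_augIdealP_holds 2⟩ = 0)
    (I : Submodule (IwasawaAlgebra 2) P)
    (hI : lengthAt (IwasawaAlgebra 2) I ⟨augIdealP 2, isPrime_augIdealP_holds 2⟩ = 0)
    (q : B →ₗ[IwasawaAlgebra 2] P ⧸ I) (hq : Function.Surjective q)
    (nm : X →ₗ[IwasawaAlgebra 2] B)
    (hnm : lengthAt (IwasawaAlgebra 2) (B ⧸ LinearMap.range nm) ⟨augIdealP 2, isPrime_augIdealP_holds 2⟩ = 0) :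
    Finite {f : X →+ M // ∀ (g : Q) (x : X), f (g • x) = g • f x} ↔
      (Module.IsTorsion (IwasawaAlgebra 2) B ∧ muInvariant 2 B = 0) := by
  have hσ3 : ∀ x : X, σ • (σ • (σ • x)) = x := smul_smul_smul_eq_self_of_kernel h4 h2 hσ hVN
  have hττ : ∀ x : X, τ • (τ • x) = x := tau_tau_V h4 h2 hσ hm₀ hτ0 hτ hVN
  have hτσ : ∀ x : X, τ • (σ • x) = σ • (σ • (τ • x)) := tau_sigma_V h4 h2 hσ hm₀ hτ0 hτ hVN
  rw [finite_equivariant_iff_fixed_isTorsion_and_muInvariant_eq_zero_S3 h4 h2 hσ hm₀ hτ0 hτ hVN]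
  exact isTorsion_and_muInvariant_eq_zero_fixed_iff_of_genusData hσ3 hττ hτσ hFW j hj I hI q hq nm hnm

end CubicDescent

end Summit.BirchSwinnertonDyer.BirchSwinnertonDyer.Theorems.AlignedTransportAtTwoFineRoad.CyclicDescent

end
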